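import Mathlib
import HarnessLib
import Summits.HubbardSuperconductivity.HubbardSuperconductivity.Theorems.KLProgrammeKLRegimeFlowReadScaleZeroTadpoleBound
import Summits.HubbardSuperconductivity.HubbardSuperconductivity.Theorems.KLProgrammeKLRegimeFlowReadScaleZeroChainSplit

/-!
# Route `KLProgramme`, crux K3 — gen-8 ENGINE-FLOW child (stmt-HubbardSuperconductivity-20437 `KLRegimeEngineV17F2`), stub (C) at `n = 0`,
# located item #22a «(C)-SCALE0-PT2», step (π3b-i): THE RAINBOW TRACE `Σ_q A((p,σ)⁺,(q,σ)⁻)A((q,σ)⁺,(p,σ)⁻)` IS A MOMENTUM SUM OF `Ψ⁰²`,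
# AND `|·| ≤ 512/ε` UNIFORMLY (`ε = β/4M`)

Seat hubbard-kl-k3c5-p1 (g13; owner of #22a).  π3a (p618339) found the diagonal two-leg kernel of the scale-`0` output through second order:
`½Uε·t₀ + ½(Uε)²·t₀·Σ_q A((p,σ̄)⁺,(q,σ̄)⁻)A((q,σ̄)⁺,(p,σ̄)⁻) + kernel₂R₃`.  The rainbow's bubble `Σ_q A·A` is, by plane-wave orthogonality on the
`4M`-grid (`2M ≤ 4M` frequencies resolved), `N·L²·(βL²)^{−4}·Σ_k Ψ⁰(k,σ̄)²` (§1, for any normal momentum covariance `Ψ`), and the phase-space sum of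
the SQUARED UV symbol is `O(β)`: `‖Ψ̂(e,ω)‖² ≤ 2c²/(ω² + Λ₀²/4)` (the UV weight vanishes on `ω² + e² ≤ Λ₀²/4` and is `≤ 1`), so by the Lorentzian
Matsubara sum of the tadpole file (p616988 `sum_range_lorentzian_le`) `Σ_{i,k⃗}‖Ψ⁰‖² ≤ (βL²)²·L²·16β/Λ₀` (§2).  Hence `|Σ_q A·A| ≤ 16/(Λ₀ε) = 512/ε`
(§3) — the rainbow coefficient is `≤ 256·U²ε·|t₀| ≤ 1024·U²ε`, an `O(1)·U²ε` diagonal entry as π3b needs for the door's value row.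

* §1 `pullback_normalCovariance_zero_one_eq_sum` (the `(+,−)` entry as ONE plane-wave sum), **`sum_pullback_zero_one_mul_swap`** (the trace identity);
* §2 `norm_sq_uvSymbolFn_le`, `sum_norm_sq_matsubara_uvSymbolFn_le`, `sum_norm_sq_uvSymbolCT_le`;
* §3 **`norm_sum_scaleZeroGridCov_mul_swap_le`** — `‖Σ_q A((p,σ)⁺,(q,σ)⁻)A((q,σ)⁺,(p,σ)⁻)‖ ≤ 512/(β/4M)` (`0 < β`).

Proofs only; no definitions; nothing asserts any stub of 20437, K3 or superconductivity.
References: BGM 2006 §2.1 (2.3)–(2.6), §2.8 (2.80) [cite: BenfattoGiulianiMastropietro2006]; Salmhofer 1999 §4.2.4 (4.59) [cite: Salmhofer1999].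
-/

noncomputable section

namespace Summit.HubbardSuperconductivity.HubbardSuperconductivity.Theorems.KLRegimeSplit

set_option linter.dupNamespace false -- summit = problem name (single-conjunct summit), D-0017

open Real Finset Complex Literature.MathematicalPhysics.QuantumLattice Literature.Probability.LatticeModels GrassmannAlgebra Matrix
open Summit.HubbardSuperconductivity.HubbardSuperconductivity.Theorems.EngineV8
open scoped ComplexConjugate

/-! ## §1 The `(+,−)` entry as a plane-wave sum and the trace identity -/

section Pullback

variable {L M N : ℕ} [NeZero L]

/-- **The `(+,−)` entry of the pulled-back normal covariance as ONE plane-wave sum**: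
`(SᵀC_ΨS)((a,σ)⁺,(b,σ')⁻) = [σ = σ']·Σ_k (βL²)⁻¹conj(e⁺_k(a))·Ψ(k,σ)·(βL²)⁻¹conj(e⁻_k(b))`. -/
theorem pullback_normalCovariance_zero_one_eq_sum (β : ℝ) (Ψ : FreqMomentum L M × Fin 2 → ℂ) (a b : GridPoint L N) (σ σ' : Fin 2) :
    ((hubbardGridSub L M β N).transpose * normalCovariance L M Ψ * hubbardGridSub L M β N) (((a, σ), 0) : GridLeg (GridPoint L N)) ((b, σ'), 1) =
      if σ = σ' then ∑ k : FreqMomentum L M,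
        (((1 / (β * (L : ℝ) ^ 2) : ℝ) : ℂ) * conj (vertexPlaneWave L M β 0 k a.2 (gridTime β N a.1))) * Ψ (k, σ) *
          (((1 / (β * (L : ℝ) ^ 2) : ℝ) : ℂ) * conj (vertexPlaneWave L M β 1 k b.2 (gridTime β N b.1))) else 0 := by
  rw [hubbardGridSub, gridSub_pullback_apply]
  by_cases hσ : σ = σ'
  · subst hσ
    rw [if_pos rfl]
    refine Finset.sum_congr rfl fun k _ => ?_
    rw [Finset.sum_eq_single_of_mem k (Finset.mem_univ _) (fun k' _ hk' => by
      rw [normalCovariance_apply]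
      simp only [Prod.mk.injEq]
      rw [if_neg (fun h => hk' h.1.symm), mul_zero, zero_mul])]
    rw [normalCovariance_apply]
    simp
  · rw [if_neg hσ]
    refine Finset.sum_eq_zero fun k _ => Finset.sum_eq_zero fun k' _ => ?_
    rw [normalCovariance_apply]
    simp only [Prod.mk.injEq, hσ, and_false, if_false, mul_zero, zero_mul]

/-- **THE TRACE IDENTITY** (`β ≠ 0`, `2M ≤ N`): `Σ_b (SᵀC_ΨS)((a,σ)⁺,(b,σ)⁻)·(SᵀC_ΨS)((b,σ)⁺,(a,σ)⁻) = N·L²·(βL²)^{−4}·Σ_k Ψ(k,σ)²`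
— plane-wave orthogonality on the grid collapses the double momentum sum; the outer phases cancel at the common point `a`. -/
theorem sum_pullback_zero_one_mul_swap {β : ℝ} (hβ : β ≠ 0) (hN : 2 * M ≤ N) (Ψ : FreqMomentum L M × Fin 2 → ℂ)
    (a : GridPoint L N) (σ : Fin 2) :
    ∑ b : GridPoint L N,
      ((hubbardGridSub L M β N).transpose * normalCovariance L M Ψ * hubbardGridSub L M β N) (((a, σ), 0) : GridLeg (GridPoint L N)) ((b, σ), 1) *
      ((hubbardGridSub L M β N).transpose * normalCovariance L M Ψ * hubbardGridSub L M β N) (((b, σ), 0) : GridLeg (GridPoint L N)) ((a, σ), 1) =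
      ((N : ℂ) * (L : ℂ) ^ 2) * (((1 / (β * (L : ℝ) ^ 2) : ℝ) : ℂ) ^ 4 * ∑ k : FreqMomentum L M, Ψ (k, σ) ^ 2) := by
  have hE : ∀ b : GridPoint L N,
      ((hubbardGridSub L M β N).transpose * normalCovariance L M Ψ * hubbardGridSub L M β N) (((a, σ), 0) : GridLeg (GridPoint L N)) ((b, σ), 1) =
        ∑ k : FreqMomentum L M, (((1 / (β * (L : ℝ) ^ 2) : ℝ) : ℂ) * conj (vertexPlaneWave L M β 0 k a.2 (gridTime β N a.1))) * Ψ (k, σ) *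
          (((1 / (β * (L : ℝ) ^ 2) : ℝ) : ℂ) * conj (vertexPlaneWave L M β 1 k b.2 (gridTime β N b.1))) := fun b => by
    rw [pullback_normalCovariance_zero_one_eq_sum, if_pos rfl]
  have hE' : ∀ b : GridPoint L N,
      ((hubbardGridSub L M β N).transpose * normalCovariance L M Ψ * hubbardGridSub L M β N) (((b, σ), 0) : GridLeg (GridPoint L N)) ((a, σ), 1) =
        ∑ k' : FreqMomentum L M, (((1 / (β * (L : ℝ) ^ 2) : ℝ) : ℂ) * conj (vertexPlaneWave L M β 0 k' b.2 (gridTime β N b.1))) * Ψ (k', σ) *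
          (((1 / (β * (L : ℝ) ^ 2) : ℝ) : ℂ) * conj (vertexPlaneWave L M β 1 k' a.2 (gridTime β N a.1))) := fun b => by
    rw [pullback_normalCovariance_zero_one_eq_sum, if_pos rfl]
  simp_rw [hE, hE']
  -- expand the product of the two sums and bring the `b`-sum inside
  have hexp : ∀ b : GridPoint L N,
      (∑ k : FreqMomentum L M, ((((1 / (β * (L : ℝ) ^ 2) : ℝ) : ℂ)) * conj (vertexPlaneWave L M β 0 k a.2 (gridTime β N a.1))) * Ψ (k, σ) *
          ((((1 / (β * (L : ℝ) ^ 2) : ℝ) : ℂ)) * conj (vertexPlaneWave L M β 1 k b.2 (gridTime β N b.1)))) *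
      (∑ k' : FreqMomentum L M, ((((1 / (β * (L : ℝ) ^ 2) : ℝ) : ℂ)) * conj (vertexPlaneWave L M β 0 k' b.2 (gridTime β N b.1))) * Ψ (k', σ) *
          ((((1 / (β * (L : ℝ) ^ 2) : ℝ) : ℂ)) * conj (vertexPlaneWave L M β 1 k' a.2 (gridTime β N a.1)))) =
      ∑ k : FreqMomentum L M, ∑ k' : FreqMomentum L M,
        ((((1 / (β * (L : ℝ) ^ 2) : ℝ) : ℂ)) ^ 4 * Ψ (k, σ) * Ψ (k', σ) * (conj (vertexPlaneWave L M β 0 k a.2 (gridTime β N a.1)) *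
          conj (vertexPlaneWave L M β 1 k' a.2 (gridTime β N a.1)))) *
        (conj (vertexPlaneWave L M β 0 k' b.2 (gridTime β N b.1)) * conj (vertexPlaneWave L M β 1 k b.2 (gridTime β N b.1))) := by
    intro b
    rw [Finset.sum_mul_sum]
    refine Finset.sum_congr rfl fun k _ => Finset.sum_congr rfl fun k' _ => ?_
    ring
  simp_rw [hexp]
  rw [Finset.sum_comm]
  simp_rw [Finset.sum_comm (s := (Finset.univ : Finset (GridPoint L N))), ← Finset.mul_sum,
    sum_conj_vertexPlaneWave_zero_mul_one_grid hβ hN]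
  simp only [mul_ite, mul_zero, Finset.sum_ite_eq', Finset.mem_univ, if_true]
  have hphase : ∀ k : FreqMomentum L M,
      conj (vertexPlaneWave L M β 0 k a.2 (gridTime β N a.1)) * conj (vertexPlaneWave L M β 1 k a.2 (gridTime β N a.1)) = 1 := by
    intro k
    rw [conj_vertexPlaneWave_zero_mul_one, sub_self]
    simp
  simp_rw [hphase, mul_one]
  rw [Finset.mul_sum, Finset.mul_sum]
  refine Finset.sum_congr rfl fun k _ => ?_
  ring

end Pullback

/-! ## §2 The phase-space sum of the squared UV symbol is `O(β)` -/

/-- **`‖Ψ̂(e,ω)‖² ≤ 2c²/(ω² + Λ²/4)`** (`0 < Λ`): the UV weight vanishes where `ω² + e² ≤ Λ²/4` and is `≤ 1` elsewhere. -/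
theorem norm_sq_uvSymbolFn_le (c : ℝ) {Λ : ℝ} (hΛ : 0 < Λ) (e ω : ℝ) :
    ‖uvSymbolFn c Λ e ω‖ ^ 2 ≤ 2 * c ^ 2 / (ω ^ 2 + Λ ^ 2 / 4) := by
  have hden : 0 < ω ^ 2 + Λ ^ 2 / 4 := by positivity
  by_cases hsupp : (ω ^ 2 + e ^ 2) / Λ ^ 2 ≤ 1 / 4
  · have hw : uvWeightFn Λ e ω = 0 := by rw [uvWeightFn]; exact salmhoferCutoff_of_le hsupp
    have h0 : ‖uvSymbolFn c Λ e ω‖ = 0 := by rw [uvSymbolFn, hw]; simp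
    rw [h0, zero_pow two_ne_zero]
    positivity
  · push Not at hsupp
    have hbig : Λ ^ 2 / 4 < ω ^ 2 + e ^ 2 := by
      rw [lt_div_iff₀ (by positivity)] at hsupp; linarith
    have hpos : 0 < ω ^ 2 + e ^ 2 := lt_trans (by positivity) hbig
    rw [uvSymbolFn, norm_mul, mul_pow, Complex.norm_real, Real.norm_eq_abs, sq_abs, resolventFn]
    simp only [add_zero]
    have hnorm : ‖(c : ℂ) / (-I * (ω : ℂ) + (e : ℂ))‖ ^ 2 = c ^ 2 / (ω ^ 2 + e ^ 2) := by
      rw [norm_div, div_pow, Complex.norm_real, Real.norm_eq_abs, sq_abs]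
      congr 1
      rw [Complex.sq_norm, Complex.normSq_apply]
      simp
      ring
    rw [hnorm]
    have hw1 : uvWeightFn Λ e ω ^ 2 ≤ 1 := by
      have h := uvWeightFn_mem_Icc Λ e ω
      nlinarith [h.1, h.2]
    calc uvWeightFn Λ e ω ^ 2 * (c ^ 2 / (ω ^ 2 + e ^ 2)) ≤ 1 * (c ^ 2 / (ω ^ 2 + e ^ 2)) :=
          mul_le_mul_of_nonneg_right hw1 (by positivity)
      _ = c ^ 2 / (ω ^ 2 + e ^ 2) := one_mul _
      _ ≤ 2 * c ^ 2 / (ω ^ 2 + Λ ^ 2 / 4) := by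
          rw [div_le_div_iff₀ hpos hden]
          nlinarith [sq_nonneg c, sq_nonneg e]

/-- **`Σ_i ‖Ψ̂(e,ω_i)‖² ≤ 16c²β/Λ`** over the truncated Matsubara set (`0 < β`, `0 < Λ`), uniformly in `M`, `e`. -/
theorem sum_norm_sq_matsubara_uvSymbolFn_le {β : ℝ} (hβ : 0 < β) (c : ℝ) {Λ : ℝ} (hΛ : 0 < Λ) (e : ℝ) (M : ℕ) :
    ∑ i : MatsubaraIdx M, ‖uvSymbolFn c Λ e (matsubaraFreq β M i)‖ ^ 2 ≤ 16 * c ^ 2 * β / Λ := by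
  have ha : 0 < Λ / 2 := by positivity
  calc ∑ i : MatsubaraIdx M, ‖uvSymbolFn c Λ e (matsubaraFreq β M i)‖ ^ 2
      ≤ ∑ i : MatsubaraIdx M, 2 * c ^ 2 / (matsubaraFreq β M i ^ 2 + Λ ^ 2 / 4) :=
        Finset.sum_le_sum fun i _ => norm_sq_uvSymbolFn_le c hΛ e _
    _ = ∑ n ∈ range M, (2 * c ^ 2 / (((2 * n + 1) * π / β) ^ 2 + Λ ^ 2 / 4) + 2 * c ^ 2 / ((-((2 * n + 1) * π / β)) ^ 2 + Λ ^ 2 / 4)) := by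
        rw [sum_matsubaraIdx_freq_eq_sum_range β M (fun ω => 2 * c ^ 2 / (ω ^ 2 + Λ ^ 2 / 4)), ← Finset.sum_add_distrib]
    _ = (2 * c ^ 2 / (Λ / 2)) * ∑ n ∈ range M, 2 * (Λ / 2) / (((2 * (n : ℝ) + 1) * π / β) ^ 2 + (Λ / 2) ^ 2) := by
        rw [Finset.mul_sum]
        refine Finset.sum_congr rfl fun n _ => ?_
        have hd : 0 < ((2 * (n : ℝ) + 1) * π / β) ^ 2 + (Λ / 2) ^ 2 := by positivity
        field_simp
        ring
    _ ≤ (2 * c ^ 2 / (Λ / 2)) * (4 * β) :=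
        mul_le_mul_of_nonneg_left (sum_range_lorentzian_le hβ ha.le M) (by positivity)
    _ = 16 * c ^ 2 * β / Λ := by field_simp; ring

variable {L M : ℕ} [NeZero L]

/-- **The phase-space sum of the squared scale-`0` UV symbol**: `Σ_k ‖Ψ⁰(k,σ)‖² ≤ (βL²)²·L²·16β/Λ₀` (`0 < β`), uniformly in `M`. -/
theorem sum_norm_sq_uvSymbolCT_le {β : ℝ} (hβ : 0 < β) (μ : ℝ) (σ : Fin 2) :
    ∑ k : FreqMomentum L M, ‖uvSymbolCT L M β μ 0 klE0 (k, σ)‖ ^ 2 ≤ (β * (L : ℝ) ^ 2) ^ 2 * (L : ℝ) ^ 2 * (16 * β / klE0) := by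
  have hΛ : (0 : ℝ) < klE0 := by norm_num [klE0]
  rw [Fintype.sum_prod_type, Finset.sum_comm]
  simp_rw [uvSymbolCT_eq_uvSymbolFn hβ μ 0 klE0]
  have hrow : ∀ kv : TorusSite 2 L, ∑ i : MatsubaraIdx M, ‖uvSymbolFn (β * (L : ℝ) ^ 2) klE0 (nambuXiCT L μ 0 kv) (matsubaraFreq β M i)‖ ^ 2 ≤
      16 * (β * (L : ℝ) ^ 2) ^ 2 * β / klE0 := fun kv => sum_norm_sq_matsubara_uvSymbolFn_le hβ _ hΛ _ M
  have hcard : (Fintype.card (TorusSite 2 L) : ℝ) = (L : ℝ) ^ 2 := by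
    have : Fintype.card (TorusSite 2 L) = L ^ 2 := by simp [TorusSite, ZMod.card]
    rw [this]; push_cast; ring
  refine (Finset.sum_le_sum fun kv _ => hrow kv).trans (le_of_eq ?_)
  rw [Finset.sum_const, Finset.card_univ, nsmul_eq_mul, hcard]
  ring

/-! ## §3 The rainbow trace of the scale-`0` grid covariance -/

/-- **`‖Σ_q A((p,σ)⁺,(q,σ)⁻)·A((q,σ)⁺,(p,σ)⁻)‖ ≤ 512/(β/4M)`** for the pulled-back scale-`0` covariance `A = contr (S_{4M}ᵀC⁰_{>e₀}S_{4M})` (`0 < β`):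
the rainbow's bubble is `O(1/ε)` uniformly in `β, L, M, μ` — so `(Uε)²·t₀·Σ_q AA = O(1)·U²ε`. -/
theorem norm_sum_scaleZeroGridCov_mul_swap_le [NeZero M] {β : ℝ} (hβ : 0 < β) (μ : ℝ) (p : GridPoint L (2 * (2 * M))) (σ : Fin 2) :
    ‖∑ q : GridPoint L (2 * (2 * M)),
        contr ℂ ((hubbardGridSub L M β (2 * (2 * M))).transpose * hubbardCovAboveCT L M β μ 0 0 klE0 *
            hubbardGridSub L M β (2 * (2 * M))) (((p, σ), 0) : GridLeg (GridPoint L (2 * (2 * M)))) ((q, σ), 1) *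
          contr ℂ ((hubbardGridSub L M β (2 * (2 * M))).transpose * hubbardCovAboveCT L M β μ 0 0 klE0 *
            hubbardGridSub L M β (2 * (2 * M))) (((q, σ), 0) : GridLeg (GridPoint L (2 * (2 * M)))) ((p, σ), 1)‖ ≤
      512 / (β / ((2 * (2 * M) : ℕ) : ℝ)) := by
  have hL : (0 : ℝ) < (L : ℝ) := by have := NeZero.ne L; positivity
  have hβL : 0 < β * (L : ℝ) ^ 2 := by positivity
  have hN : (0 : ℝ) < ((2 * (2 * M) : ℕ) : ℝ) := by have := NeZero.ne M; positivity
  simp_rw [contr_scaleZeroGridCov_eq_neg, neg_mul_neg, hubbardCovAboveCT_zero_seed_eq_normalCovariance_uvSymbolCT]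
  have hu : ‖(((1 / (β * (L : ℝ) ^ 2) : ℝ) : ℂ))‖ = 1 / (β * (L : ℝ) ^ 2) := by
    rw [Complex.norm_real, Real.norm_eq_abs, abs_of_pos (by positivity)]
  rw [sum_pullback_zero_one_mul_swap hβ.ne' (by omega) _ p σ, norm_mul, norm_mul, norm_mul, norm_pow, norm_pow,
    Complex.norm_natCast, Complex.norm_natCast, hu]
  have hsq : ‖∑ k : FreqMomentum L M, uvSymbolCT L M β μ 0 klE0 (k, σ) ^ 2‖ ≤ (β * (L : ℝ) ^ 2) ^ 2 * (L : ℝ) ^ 2 * (16 * β / klE0) := by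
    refine (norm_sum_le _ _).trans ?_
    simp_rw [norm_pow]
    exact sum_norm_sq_uvSymbolCT_le hβ μ σ
  calc ((2 * (2 * M) : ℕ) : ℝ) * (L : ℝ) ^ 2 * ((1 / (β * (L : ℝ) ^ 2)) ^ 4 * ‖∑ k : FreqMomentum L M, uvSymbolCT L M β μ 0 klE0 (k, σ) ^ 2‖)
      ≤ ((2 * (2 * M) : ℕ) : ℝ) * (L : ℝ) ^ 2 * ((1 / (β * (L : ℝ) ^ 2)) ^ 4 * ((β * (L : ℝ) ^ 2) ^ 2 * (L : ℝ) ^ 2 * (16 * β / klE0))) := by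
        gcongr
    _ = 512 / (β / ((2 * (2 * M) : ℕ) : ℝ)) := by
        simp only [klE0]
        field_simp
        ring

end Summit.HubbardSuperconductivity.HubbardSuperconductivity.Theorems.KLRegimeSplit

end
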